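/-
b2b-lace packet, LITERATURE seat gen 18 (unit `b2b-lace-lit-g18`).  (S2b)-IMPR, the H₁ leaf (L3), analytic half:
the MASSIVE WEIGHTED LINE `Σ_y |y|² C_μ(y) I^μ_{n,l}(x − y) = μ I^μ_{n+2,l+1}(x) − (μ²/d) I^μ_{n+3,l}(x)
+ (μ²/2d²) Σ_{±ι} I^μ_{n+3,l}(x ± 2e_ι)` (x-space, no Fourier derivative), and from it the two sharp one-sided
bounds (S1a)/(S1b) of the packet's L3 spec for `X_{m,l}(x) = ∫ Ĉ*^{m+2} M̂* D̂^l D̂^{(x)} dP/(2π)^d`.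
d-generic; no numeral, no dimension sentence, no named fact; every existing module untouched.
-/
import Literature.Probability.FitznerVanDerHofstad2017.SrwIntegralMassive
import Literature.Probability.FitznerVanDerHofstad2017.NobleF3WeightedLine
import HarnessLib

/-!
# The massive weighted line and the corrected Step-1 bounds (S1a)/(S1b) of [NoBLE17] §3.3.5

CITATION HEADER (PLACEMENT v2). Part of a certified REPRODUCTION of R. Fitzner, R. van der Hofstad,
*Generalized approach to the non-backtracking lace expansion*, Probab. Theory Related Fields 169 (2017)
1041–1119 [NoBLE17] (arXiv:1506.07969), §3.3.3 (3.27)–(3.30) p. 1070 and §3.3.5 Step 1 (3.58)–(3.62)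
pp. 1074–1076, as consumed by [FvdH17] (EJP 22 (2017) no. 43) Prop. 2.2 / §3.3 (the `f₃` bound).

> (3.61)–(3.62) p. 1076: "We first recall the rearrangement of (3.27)–(3.28) to see that, for `m ≥ 0`,
> `∫ D̂(k)^l Ĉ*(k)^{m+2} M̂*(k) e^{ik·x} d^dk/(2π)^d = Σ_y ‖y‖₂² C*(y)(D^{⋆l} ⋆ (C*)^{⋆m})(x−y)
>  ≤ (α_{F,z})^{−(m+1)} Σ_y ‖y‖₂² C(y)(D^{⋆l} ⋆ C^{⋆m})(x−y) = (α_{F,z})^{−(m+1)} 𝓘_{m,l}(x)`."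

READING NOTE (packet DIVERGENCE.md D80; nothing here decides it). The first equality of (3.61) holds for a
UNIT-coefficient massive walk only; for `Ĉ* = a Ĉ_μ` (`a = (c₀+α_F)⁻¹`, `μ = α_F a`, (3.41)) the Laplacian-free
expansion (`SrwIntegralMassive.integral_Cstar_pow_Mstar_eq`) and the massive weighted line proved HERE give instead

  `X_{m,l}(x) = a^{m+2} 𝓙^μ_{m+2,l}(x) + (α_F − 1) a^{m+3} [ I^μ_{m+3,l}(x)/d − Σ_{±ι} I^μ_{m+3,l}(x ± 2e_ι)/(2d²) ]`,
  `μ 𝓙^μ_{N,l}(x) = Σ_y |y|² C_μ(y) I^μ_{N−2,l}(x − y) ≥ 0` and `≤ 𝓙_{N−2,l}(x) = srwJ d N l x`,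

whence the two bounds the packet's slot algebra (`NobleH1SlotAlgebra`, hypotheses `hX`, `hX'`) consumes:

* (S1a) `integral_Cstar_pow_Mstar_le`:
  `X_{m,l}(x) ≤ srwJ d (m+2) l x / α_F^{m+2} + (α_F − 1) I_{m+3,l}(x)/(d α_F^{m+3})`;
* (S1b) `neg_le_integral_Cstar_pow_Mstar`:
  `−(α_F − 1) Σ_{±ι} I_{m+3,l}(x ± 2e_ι)/(2d² α_F^{m+3}) ≤ X_{m,l}(x)`,

for `2(m+3)+1 ≤ d`, `α_F ≥ 1`, on the STRICT window `c_F + α_F + R̂_F(0) < 1` (the open interval `p < p_c`,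
where `1 − F̂_z(0) > 0`; the closure `c₀ = 0` is the critical case `Ĉ* = Ĉ/α_F` and is not treated here).

## What is here

* `sum_box_prob_mul_srwIm`, `tsum_prob_mul_srwIm` — Chapman–Kolmogorov against the massive tables
  `Σ_y p_m(y) I^μ_{n,l}(x−y) = I^μ_{n,l+m}(x)`;
* `hasSum_pow_mul_prob` — `C_μ(y) := Σ_m μ^m p_m(y) = I^μ_{1,0}(y)`;
* `hasSum_succ_mul_pow_mul_srwIm`, `hasSum_succ_mul_succ_mul_pow_mul_srwIm` — the weighted resummations
  `Σ_m (m+1) μ^m I^μ_{n,l+m} = I^μ_{n+2,l}`, `Σ_m (m+1)(m+2) μ^m I^μ_{n,l+m} = 2 I^μ_{n+3,l}`;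
* `srwJm d μ N l x` (`= srwJ` at `μ = 1` up to the factor conventions below) and
  **`hasSum_weightedLine_massive`**: `Σ_y |y|² I^μ_{1,0}(y) I^μ_{n,l}(x−y) = srwJm d μ (n+2) l x`, hence
  `srwJm_nonneg` and `srwJm_le_srwJ` (termwise comparison with the critical weighted line `hasSum_weightedLine`);
* (S1a)/(S1b) as above.

Pattern = `NobleF3WeightedLine` (oracle-g8) with `μ`-weights; the second-moment identity of the `m`-step law
(`normSq_mul_prob_add_two`) and the row/shift bookkeeping (`probT`, `shiftTwo`, `sum_dir_shiftTwo_eq`) are REUSED.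
[cite: FitznerVanDerHofstad2016NoBLE, §3.3.3 (3.27)–(3.30) p. 1070, §3.3.4 (3.41)–(3.42) p. 1072, §3.3.5 (3.58)–(3.62)
 pp. 1074–1076; HaraSlade1992b, App. B (SRW integral bounds)]
-/

noncomputable section

open MeasureTheory Real Finset Filter Topology
open scoped BigOperators

namespace Literature.Probability.FitznerVanDerHofstad2017

open Literature.Barriers.CriticalPhenomena
open Literature.Barriers.CriticalPhenomena.Slade2006Prop53 (P)
open Literature.Probability.LatticeModels
open Literature.Probability.RandomPlanarGeometry.SAW.Zd (normSq normSq_nonneg)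

variable {d : ℕ}

/-! ### The `m`-step law against the massive tables -/

/-- **Chapman–Kolmogorov against `I^μ_{n,l}`**: `Σ_{y ∈ box m} p_m(y) I^μ_{n,l}(x − y) = I^μ_{n,l+m}(x)` (`0 ≤ μ < 1`;
no condition on `d`). [cite: FitznerVanDerHofstad2016NoBLE, §3.3.3 (3.35) p. 1071 (I_{n,l} = D^{⋆l} ⋆ C^{⋆n})] -/
theorem sum_box_prob_mul_srwIm {μ : ℝ} (hμ0 : 0 ≤ μ) (hμ1 : μ < 1) : ∀ (n m l : ℕ) (x : Site d),
    ∑ y ∈ box d m, SRW.prob d m y * srwIm d μ n l (x - y) = srwIm d μ n (l + m) x := by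
  intro n
  induction n with
  | zero =>
    intro m l x
    simp_rw [srwIm_zero_left, srwI_zero_eq_srwLaw, ← prob_eq_srwLaw]
    rw [add_comm, SRW.prob_add m l x]
  | succ n ih =>
    intro m l x
    have hlim : ∀ z, Tendsto (fun N => ∑ j ∈ Finset.range N, μ ^ j * srwIm d μ n (l + j) z) atTop
        (𝓝 (srwIm d μ (n + 1) l z)) := fun z => (hasSum_pow_mul_srwIm hμ0 hμ1 n l z).tendsto_sum_nat
    have h1 : Tendsto (fun N => ∑ y ∈ box d m, SRW.prob d m y *
        ∑ j ∈ Finset.range N, μ ^ j * srwIm d μ n (l + j) (x - y)) atTop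
        (𝓝 (∑ y ∈ box d m, SRW.prob d m y * srwIm d μ (n + 1) l (x - y))) :=
      tendsto_finsetSum _ fun y _ => (hlim (x - y)).const_mul _
    have h2 : Tendsto (fun N => ∑ j ∈ Finset.range N, μ ^ j * srwIm d μ n (l + m + j) x) atTop
        (𝓝 (srwIm d μ (n + 1) (l + m) x)) := (hasSum_pow_mul_srwIm hμ0 hμ1 n (l + m) x).tendsto_sum_nat
    have heq : (fun N => ∑ y ∈ box d m, SRW.prob d m y *
        ∑ j ∈ Finset.range N, μ ^ j * srwIm d μ n (l + j) (x - y))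
        = fun N => ∑ j ∈ Finset.range N, μ ^ j * srwIm d μ n (l + m + j) x := by
      funext N
      simp_rw [Finset.mul_sum]
      rw [Finset.sum_comm]
      refine Finset.sum_congr rfl fun j _ => ?_
      have := ih m (l + j) x
      rw [add_right_comm] at this
      rw [← this, Finset.mul_sum]
      refine Finset.sum_congr rfl fun y _ => ?_
      ring
    rw [heq] at h1
    exact tendsto_nhds_unique h1 h2

/-- The same with the sum over all of `ℤ^d`. [folklore] -/
theorem tsum_prob_mul_srwIm {μ : ℝ} (hμ0 : 0 ≤ μ) (hμ1 : μ < 1) (n m l : ℕ) (x : Site d) :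
    ∑' y, SRW.prob d m y * srwIm d μ n l (x - y) = srwIm d μ n (l + m) x := by
  rw [tsum_eq_sum (s := box d m) fun y hy => by rw [SRW.prob_eq_zero_of_not_mem_box hy, zero_mul]]
  exact sum_box_prob_mul_srwIm hμ0 hμ1 n m l x

/-- The massive tail identity restated with the summation index in front: `HasSum (j ↦ μ^j I^μ_{n,l+j}) (I^μ_{n+1,l})`.
[cite: FitznerVanDerHofstad2016NoBLE, (3.41) p. 1072] -/
theorem hasSum_srwIm_tail {μ : ℝ} (hμ0 : 0 ≤ μ) (hμ1 : μ < 1) (n l : ℕ) (x : Site d) :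
    HasSum (fun j => μ ^ j * srwIm d μ n (l + j) x) (srwIm d μ (n + 1) l x) :=
  hasSum_pow_mul_srwIm hμ0 hμ1 n l x

/-- **The massive Green's function is `I^μ_{1,0}`**: `C_μ(y) = Σ_m μ^m p_m(y) = I^μ_{1,0}(y)`.
[cite: FitznerVanDerHofstad2016NoBLE, §3.3.4 (3.41) p. 1072 (C_λ)] -/
theorem hasSum_pow_mul_prob {μ : ℝ} (hμ0 : 0 ≤ μ) (hμ1 : μ < 1) (y : Site d) :
    HasSum (fun m => μ ^ m * SRW.prob d m y) (srwIm d μ 1 0 y) := by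
  have h := hasSum_srwIm_tail (d := d) hμ0 hμ1 0 0 y
  simp_rw [zero_add, srwIm_zero_left, srwI_zero_eq_srwLaw, ← prob_eq_srwLaw] at h
  exact h

/-- **`I^μ_{n+2,l}(x) = Σ_m (m+1) μ^m I^μ_{n,l+m}(x)`** (`0 ≤ μ < 1`). [folklore] -/
theorem hasSum_succ_mul_pow_mul_srwIm {μ : ℝ} (hμ0 : 0 ≤ μ) (hμ1 : μ < 1) (n l : ℕ) (x : Site d) :
    HasSum (fun m : ℕ => ((m : ℝ) + 1) * μ ^ m * srwIm d μ n (l + m) x) (srwIm d μ (n + 2) l x) := by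
  set F : ℕ × ℕ → ℝ := fun p => μ ^ p.1 * (μ ^ p.2 * srwIm d μ n (l + p.1 + p.2) x) with hF
  have hF0 : 0 ≤ F := fun p =>
    mul_nonneg (pow_nonneg hμ0 _) (mul_nonneg (pow_nonneg hμ0 _) (srwIm_nonneg hμ0 hμ1 _ _ _))
  have hrow : ∀ j, HasSum (fun i => F (j, i)) (μ ^ j * srwIm d μ (n + 1) (l + j) x) := fun j =>
    (hasSum_srwIm_tail hμ0 hμ1 n (l + j) x).mul_left _
  have hcol : HasSum (fun j => μ ^ j * srwIm d μ (n + 1) (l + j) x) (srwIm d μ (n + 2) l x) :=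
    hasSum_srwIm_tail hμ0 hμ1 (n + 1) l x
  have h := hasSum_sum_antidiagonal (hasSum_prod_of_nonneg_of_rows hF0 hrow hcol)
  convert h using 1
  funext N
  have : ∀ p ∈ antidiagonal N, F p = μ ^ N * srwIm d μ n (l + N) x := by
    intro p hp
    rw [Finset.mem_antidiagonal] at hp
    simp only [hF, ← hp, add_assoc, pow_add]
    ring
  rw [Finset.sum_congr rfl this, Finset.sum_const, Finset.Nat.card_antidiagonal, nsmul_eq_mul]
  push_cast; ring

/-- **`2 I^μ_{n+3,l}(x) = Σ_m (m+1)(m+2) μ^m I^μ_{n,l+m}(x)`** (`0 ≤ μ < 1`). [folklore] -/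
theorem hasSum_succ_mul_succ_mul_pow_mul_srwIm {μ : ℝ} (hμ0 : 0 ≤ μ) (hμ1 : μ < 1) (n l : ℕ) (x : Site d) :
    HasSum (fun m : ℕ => ((m : ℝ) + 1) * ((m : ℝ) + 2) * μ ^ m * srwIm d μ n (l + m) x)
      (2 * srwIm d μ (n + 3) l x) := by
  set F : ℕ × ℕ → ℝ := fun p => μ ^ p.1 * (((p.2 : ℝ) + 1) * μ ^ p.2 * srwIm d μ n (l + p.1 + p.2) x)
    with hF
  have hF0 : 0 ≤ F := fun p => mul_nonneg (pow_nonneg hμ0 _)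
    (mul_nonneg (mul_nonneg (by positivity) (pow_nonneg hμ0 _)) (srwIm_nonneg hμ0 hμ1 _ _ _))
  have hrow : ∀ j, HasSum (fun i => F (j, i)) (μ ^ j * srwIm d μ (n + 2) (l + j) x) := fun j =>
    (hasSum_succ_mul_pow_mul_srwIm hμ0 hμ1 n (l + j) x).mul_left _
  have hcol : HasSum (fun j => μ ^ j * srwIm d μ (n + 2) (l + j) x) (srwIm d μ (n + 3) l x) :=
    hasSum_srwIm_tail hμ0 hμ1 (n + 2) l x
  have h := (hasSum_sum_antidiagonal (hasSum_prod_of_nonneg_of_rows hF0 hrow hcol)).mul_left 2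
  have hg : ∀ M : ℕ, 2 * ∑ k ∈ Finset.range (M + 1), (((M - k : ℕ) : ℝ) + 1) =
      ((M : ℝ) + 1) * ((M : ℝ) + 2) := by
    intro M
    have hrefl := Finset.sum_range_reflect (fun j => ((j : ℝ) + 1)) (M + 1)
    simp only [add_tsub_cancel_right] at hrefl
    rw [hrefl]
    clear hrefl
    induction M with
    | zero => norm_num
    | succ M ih =>
      rw [Finset.sum_range_succ, mul_add, ih]; push_cast; ring
  have hfun : (fun N => 2 * ∑ p ∈ antidiagonal N, F p)
      = fun m : ℕ => ((m : ℝ) + 1) * ((m : ℝ) + 2) * μ ^ m * srwIm d μ n (l + m) x := by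
    funext N
    have : ∀ p ∈ antidiagonal N, F p = ((p.2 : ℝ) + 1) * (μ ^ N * srwIm d μ n (l + N) x) := by
      intro p hp
      rw [Finset.mem_antidiagonal] at hp
      simp only [hF, ← hp, add_assoc, pow_add]
      ring
    rw [Finset.sum_congr rfl this, ← Finset.sum_mul, Finset.Nat.sum_antidiagonal_eq_sum_range_succ
      (fun i j => ((j : ℝ) + 1)) N, ← mul_assoc, hg N]
    ring
  rw [hfun] at h
  exact h

/-! ### The rows of the massive weighted line -/

/-- The `T_m` row against the massive table: `Σ_y T_m(y) I^μ_{n,l}(x − y) = S₂(I^μ_{n,l+m})(x) − I^μ_{n,l+m}(x)`. [folklore] -/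
theorem tsum_probT_mul_srwIm {μ : ℝ} (hμ0 : 0 ≤ μ) (hμ1 : μ < 1) (n m l : ℕ) (x : Site d) :
    ∑' y, probT d m y * srwIm d μ n l (x - y) =
      shiftTwo (srwIm d μ n (l + m)) x - srwIm d μ n (l + m) x := by
  have hT : ∀ y, probT d m y * srwIm d μ n l (x - y) =
      (∑ w, SRW.prob d m (y - 2 • SRW.stepVec w) * srwIm d μ n l (x - y)) / (2 * d)
        - SRW.prob d m y * srwIm d μ n l (x - y) := by
    intro y; unfold probT shiftTwo; rw [sub_mul, div_mul_eq_mul_div, Finset.sum_mul]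
  simp_rw [hT]
  have hS1 : Summable fun y =>
      (∑ w, SRW.prob d m (y - 2 • SRW.stepVec w) * srwIm d μ n l (x - y)) / (2 * d) :=
    (summable_sum fun w _ => summable_prob_shift_mul m (srwIm d μ n l) x _).div_const _
  rw [hS1.tsum_sub (summable_prob_mul m _), tsum_prob_mul_srwIm hμ0 hμ1, tsum_div_const,
    Summable.tsum_finsetSum (fun w _ => summable_prob_shift_mul m (srwIm d μ n l) x _)]
  unfold shiftTwo
  congr 2
  refine Finset.sum_congr rfl fun w _ => ?_
  rw [tsum_prob_shift_mul, tsum_prob_mul_srwIm hμ0 hμ1]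

/-- The rows `Σ_y |y|² p_m(y) I^μ_{n,l}(x − y)` for `m = 0`, `1`, `m + 2`. [folklore] -/
theorem tsum_normSq_mul_prob_mul_srwIm (hd1 : 1 ≤ d) {μ : ℝ} (hμ0 : 0 ≤ μ) (hμ1 : μ < 1) (n l : ℕ)
    (x : Site d) :
    (∑' y, normSq y * SRW.prob d 0 y * srwIm d μ n l (x - y) = 0) ∧
    (∑' y, normSq y * SRW.prob d 1 y * srwIm d μ n l (x - y) = srwIm d μ n (l + 1) x) ∧
    (∀ m, ∑' y, normSq y * SRW.prob d (m + 2) y * srwIm d μ n l (x - y) =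
      (m + 2) * srwIm d μ n (l + (m + 2)) x
        + (m + 2) * (m + 1) / (2 * d) * (shiftTwo (srwIm d μ n (l + m)) x - srwIm d μ n (l + m) x)) := by
  refine ⟨?_, ?_, fun m => ?_⟩
  · simp_rw [normSq_mul_prob_zero, zero_mul]; exact tsum_zero
  · simp_rw [normSq_mul_prob_one hd1]; exact tsum_prob_mul_srwIm hμ0 hμ1 n 1 l x
  · have hT : ∀ y, probT d m y * srwIm d μ n l (x - y) =
        (∑ w, SRW.prob d m (y - 2 • SRW.stepVec w) * srwIm d μ n l (x - y)) / (2 * d)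
          - SRW.prob d m y * srwIm d μ n l (x - y) := by
      intro y; unfold probT shiftTwo; rw [sub_mul, div_mul_eq_mul_div, Finset.sum_mul]
    have hS2 : Summable fun y => probT d m y * srwIm d μ n l (x - y) := by
      simp_rw [hT]
      exact ((summable_sum fun w _ => summable_prob_shift_mul m (srwIm d μ n l) x _).div_const _).sub
        (summable_prob_mul m _)
    have hy : ∀ y, normSq y * SRW.prob d (m + 2) y * srwIm d μ n l (x - y) =
        (m + 2) * (SRW.prob d (m + 2) y * srwIm d μ n l (x - y))
          + (m + 2) * (m + 1) / (2 * d) * (probT d m y * srwIm d μ n l (x - y)) := by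
      intro y; rw [normSq_mul_prob_add_two hd1]; ring
    simp_rw [hy]
    rw [((summable_prob_mul _ _).mul_left _).tsum_add (hS2.mul_left _), tsum_mul_left,
      tsum_mul_left, tsum_prob_mul_srwIm hμ0 hμ1, tsum_probT_mul_srwIm hμ0 hμ1]

/-! ### The massive weighted line -/

/-- `𝓙^μ`-combination of massive tables (the value of the massive weighted line):
`srwJm d μ N l x = μ I^μ_{N,l+1}(x) − (μ²/d) I^μ_{N+1,l}(x) + (μ²/2d²) Σ_ι (I^μ_{N+1,l}(x+2e_ι) + I^μ_{N+1,l}(x−2e_ι))`.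
[cite: FitznerVanDerHofstad2016NoBLE, §3.3.3 (3.30) p. 1070] -/
def srwJm (d : ℕ) (μ : ℝ) (N l : ℕ) (x : Site d) : ℝ :=
  μ * srwIm d μ N (l + 1) x - μ ^ 2 / d * srwIm d μ (N + 1) l x
    + μ ^ 2 / (2 * (d : ℝ) ^ 2) *
        ∑ ι : Fin d, (srwIm d μ (N + 1) l (x + axisVec ι 2) + srwIm d μ (N + 1) l (x - axisVec ι 2))

/-- **The massive weighted line** ([NoBLE17] (3.27)–(3.30) for the walk with generating parameter `μ/(2d)`,
x-space form): `Σ_y |y|² I^μ_{1,0}(y) I^μ_{n,l}(x − y) = srwJm d μ (n+2) l x` for `0 ≤ μ < 1` and `d ≥ 1`,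
the family being summable. [cite: FitznerVanDerHofstad2016NoBLE, §3.3.3 (3.27)–(3.30) p. 1070, §3.3.4 (3.41) p. 1072] -/
theorem hasSum_weightedLine_massive (hd1 : 1 ≤ d) {μ : ℝ} (hμ0 : 0 ≤ μ) (hμ1 : μ < 1) (n l : ℕ)
    (x : Site d) :
    HasSum (fun y => normSq y * srwIm d μ 1 0 y * srwIm d μ n l (x - y)) (srwJm d μ (n + 2) l x) := by
  have hd' : (2 * d : ℝ) ≠ 0 := by
    have : (1 : ℝ) ≤ d := by exact_mod_cast hd1
    positivity
  -- the double family `G (m, y) = μ^m |y|² p_m(y) I^μ_{n,l}(x − y)`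
  set G : ℕ × Site d → ℝ := fun p => μ ^ p.1 * (normSq p.2 * SRW.prob d p.1 p.2 * srwIm d μ n l (x - p.2))
    with hG
  have hG0 : 0 ≤ G := fun p => mul_nonneg (pow_nonneg hμ0 _)
    (mul_nonneg (mul_nonneg (normSq_nonneg _) (SRW.prob_nonneg _ _)) (srwIm_nonneg hμ0 hμ1 _ _ _))
  obtain ⟨hr0, hr1, hr2⟩ := tsum_normSq_mul_prob_mul_srwIm hd1 hμ0 hμ1 n l x
  set a : ℕ → ℝ := fun m => μ ^ m * ((m : ℝ) * srwIm d μ n (l + m) x) with ha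
  set b : ℕ → ℝ := fun m => μ ^ m * ((m : ℝ) * ((m : ℝ) - 1) / (2 * d) *
    (shiftTwo (srwIm d μ n (l + m - 2)) x - srwIm d μ n (l + m - 2) x)) with hb
  have hrowsum : ∀ m, Summable fun y => G (m, y) := fun m => by
    have : (fun y => G (m, y)) = fun y => SRW.prob d m y * (μ ^ m * normSq y * srwIm d μ n l (x - y)) := by
      funext y; simp only [hG]; ring
    rw [this]; exact summable_prob_mul m _
  have hrowval : ∀ m, ∑' y, G (m, y) = a m + b m := by
    intro m
    have hGm : (fun y => G (m, y)) = fun y => μ ^ m * (normSq y * SRW.prob d m y * srwIm d μ n l (x - y)) := by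
      funext y; simp only [hG]
    rw [hGm, tsum_mul_left]
    match m with
    | 0 => simp [ha, hb, hr0]
    | 1 => simp [ha, hb, hr1]
    | m + 2 =>
      simp only [ha, hb]
      rw [hr2 m, show l + (m + 2) - 2 = l + m by omega]
      push_cast; ring
  have hrow : ∀ m, HasSum (fun y => G (m, y)) (a m + b m) := fun m =>
    hrowval m ▸ (hrowsum m).hasSum
  -- column series
  have haS : HasSum a (μ * srwIm d μ (n + 2) (l + 1) x) := by
    have h := (hasSum_succ_mul_pow_mul_srwIm hμ0 hμ1 n (l + 1) x).mul_left μ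
    have hfun : (fun m => a (m + 1)) = fun m : ℕ => μ * (((m : ℝ) + 1) * μ ^ m * srwIm d μ n (l + 1 + m) x) := by
      funext m
      simp only [ha, show l + (m + 1) = l + 1 + m by omega, pow_succ]
      push_cast; ring
    have h' : HasSum (fun m => a (m + 1)) (μ * srwIm d μ (n + 2) (l + 1) x) := by rw [hfun]; exact h
    have := (hasSum_nat_add_iff (f := a) 1).1 h'
    simpa [ha] using this
  have hbS : HasSum b (μ ^ 2 * ((shiftTwo (fun z => 2 * srwIm d μ (n + 3) l z) x - 2 * srwIm d μ (n + 3) l x)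
      / (2 * d))) := by
    have h3 : ∀ z, HasSum (fun m : ℕ => ((m : ℝ) + 1) * ((m : ℝ) + 2) * μ ^ m * srwIm d μ n (l + m) z)
        (2 * srwIm d μ (n + 3) l z) := fun z => hasSum_succ_mul_succ_mul_pow_mul_srwIm hμ0 hμ1 n l z
    have hS : HasSum (fun m : ℕ => shiftTwo (fun z => ((m : ℝ) + 1) * ((m : ℝ) + 2) * μ ^ m
        * srwIm d μ n (l + m) z) x) (shiftTwo (fun z => 2 * srwIm d μ (n + 3) l z) x) := by
      unfold shiftTwo
      exact (hasSum_sum fun w _ => h3 (x - 2 • SRW.stepVec w)).div_const _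
    have hfun : (fun m => b (m + 2)) = fun m : ℕ => μ ^ 2 *
        ((shiftTwo (fun z => ((m : ℝ) + 1) * ((m : ℝ) + 2) * μ ^ m * srwIm d μ n (l + m) z) x
          - ((m : ℝ) + 1) * ((m : ℝ) + 2) * μ ^ m * srwIm d μ n (l + m) x) / (2 * d)) := by
      funext m
      simp only [hb]
      rw [show l + (m + 2) - 2 = l + m by omega, shiftTwo_const_mul, pow_add]
      push_cast; ring
    have h' : HasSum (fun m => b (m + 2)) (μ ^ 2 * ((shiftTwo (fun z => 2 * srwIm d μ (n + 3) l z) x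
        - 2 * srwIm d μ (n + 3) l x) / (2 * d))) := by
      rw [hfun]; exact ((hS.sub (h3 x)).div_const (2 * (d : ℝ))).mul_left _
    have := (hasSum_nat_add_iff (f := b) 2).1 h'
    simpa [hb, Finset.sum_range_succ] using this
  have hval : μ * srwIm d μ (n + 2) (l + 1) x + μ ^ 2 * ((shiftTwo (fun z => 2 * srwIm d μ (n + 3) l z) x
      - 2 * srwIm d μ (n + 3) l x) / (2 * d)) = srwJm d μ (n + 2) l x := by
    rw [srwJm, shiftTwo_const_mul]
    unfold shiftTwo
    rw [sum_dir_shiftTwo_eq]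
    field_simp
    ring
  have hcol : HasSum (fun m => a m + b m) (srwJm d μ (n + 2) l x) := by
    have := haS.add hbS
    rw [hval] at this
    exact this
  have hGsum : HasSum G (srwJm d μ (n + 2) l x) := hasSum_prod_of_nonneg_of_rows hG0 hrow hcol
  have hcolval : ∀ y, HasSum (fun m => G (m, y)) (normSq y * srwIm d μ 1 0 y * srwIm d μ n l (x - y)) := by
    intro y
    have h := ((hasSum_pow_mul_prob hμ0 hμ1 y).mul_left (normSq y)).mul_right (srwIm d μ n l (x - y))
    have hfun : (fun m => G (m, y)) = fun m => normSq y * (μ ^ m * SRW.prob d m y) * srwIm d μ n l (x - y) := by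
      funext m; simp only [hG]; ring
    rw [hfun]; exact h
  have hG' : HasSum (G ∘ (Equiv.prodComm (Site d) ℕ)) (srwJm d μ (n + 2) l x) :=
    (Equiv.hasSum_iff _).2 hGsum
  exact hG'.prod_fiberwise fun y => by simpa using hcolval y

/-- **`srwJm ≥ 0`** (a sum of nonnegative terms). [cite: FitznerVanDerHofstad2016NoBLE, §3.3.3 (3.29)–(3.30) p. 1070] -/
theorem srwJm_nonneg (hd1 : 1 ≤ d) {μ : ℝ} (hμ0 : 0 ≤ μ) (hμ1 : μ < 1) (n l : ℕ) (x : Site d) :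
    0 ≤ srwJm d μ (n + 2) l x :=
  (hasSum_weightedLine_massive hd1 hμ0 hμ1 n l x).nonneg fun _ =>
    mul_nonneg (mul_nonneg (normSq_nonneg _) (srwIm_nonneg hμ0 hμ1 _ _ _)) (srwIm_nonneg hμ0 hμ1 _ _ _)

/-- **`srwJm ≤ srwJ`**: the massive weighted line is dominated termwise by the critical one (`C_μ ≤ C`,
`I^μ ≤ I`), for `2(n+3)+1 ≤ d`. [cite: FitznerVanDerHofstad2016NoBLE, §3.3.4 (3.42) p. 1072, §3.3.5 (3.62) p. 1076] -/
theorem srwJm_le_srwJ {n : ℕ} (hd : 2 * (n + 3) + 1 ≤ d) {μ : ℝ} (hμ0 : 0 ≤ μ) (hμ1 : μ < 1) (l : ℕ)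
    (x : Site d) : srwJm d μ (n + 2) l x ≤ srwJ d (n + 2) l x :=
  hasSum_le (fun y => mul_le_mul (mul_le_mul_of_nonneg_left
      (srwIm_le_srwI (n := 1) (by omega) hμ0 hμ1 0 y) (normSq_nonneg _))
    (srwIm_le_srwI (n := n) (by omega) hμ0 hμ1 l _) (srwIm_nonneg hμ0 hμ1 _ _ _)
    (mul_nonneg (normSq_nonneg _) (srwI_nonneg 1 (by omega) _ _)))
    (hasSum_weightedLine_massive (by omega) hμ0 hμ1 n l x) (hasSum_weightedLine hd l x)

/-! ### (S1a)/(S1b): the corrected Step-1 bounds for `X_{m,l}` -/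

/-- The real-inequality core of (S1a): `W`-part through `μ W ≤ 𝓙` and `a ≤ α⁻¹`, residual through `I^μ ≤ I`, `S^μ ≥ 0`.
[cite: FitznerVanDerHofstad2016NoBLE, §3.3.5 (3.62) p. 1076] -/
theorem stepOne_upper_alg {a α μ dR W I S Jc Ic : ℝ} (m : ℕ) (hμ : μ = α * a) (ha : 0 < a) (hα : 1 ≤ α)
    (hale : a ≤ 1 / α) (hd : 0 < dR) (hW0 : 0 ≤ W) (hWle : μ * W ≤ Jc) (hI0 : 0 ≤ I) (hIle : I ≤ Ic)
    (hS0 : 0 ≤ S) :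
    a ^ (m + 2) * W + (α - 1) * a ^ (m + 3) * (I / dR - S / (2 * dR ^ 2))
      ≤ Jc / α ^ (m + 2) + (α - 1) * Ic / (dR * α ^ (m + 3)) := by
  have hα0 : 0 < α := by linarith
  have haq : ∀ q : ℕ, a ^ q ≤ (1 / α) ^ q := fun q => pow_le_pow_left₀ ha.le hale q
  have hJ0 : 0 ≤ Jc := le_trans (mul_nonneg (by rw [hμ]; positivity) hW0) hWle
  have h1 : a ^ (m + 2) * W ≤ Jc / α ^ (m + 2) := by
    have e : a ^ (m + 2) * W = a ^ (m + 1) / α * (μ * W) := by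
      rw [hμ, pow_succ]; field_simp
    rw [e]
    calc a ^ (m + 1) / α * (μ * W) ≤ a ^ (m + 1) / α * Jc :=
          mul_le_mul_of_nonneg_left hWle (by positivity)
      _ ≤ (1 / α) ^ (m + 1) / α * Jc := by
          apply mul_le_mul_of_nonneg_right _ hJ0
          exact div_le_div_of_nonneg_right (haq (m + 1)) hα0.le
      _ = Jc / α ^ (m + 2) := by
          rw [one_div, inv_pow, pow_succ]; field_simp; ring
  have h2 : (α - 1) * a ^ (m + 3) * (I / dR - S / (2 * dR ^ 2)) ≤ (α - 1) * Ic / (dR * α ^ (m + 3)) := by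
    have hstep1 : I / dR - S / (2 * dR ^ 2) ≤ Ic / dR := by
      have : 0 ≤ S / (2 * dR ^ 2) := by positivity
      have : I / dR ≤ Ic / dR := div_le_div_of_nonneg_right hIle hd.le
      linarith
    have hIc0 : 0 ≤ Ic / dR := div_nonneg (le_trans hI0 hIle) hd.le
    calc (α - 1) * a ^ (m + 3) * (I / dR - S / (2 * dR ^ 2))
        ≤ (α - 1) * a ^ (m + 3) * (Ic / dR) :=
          mul_le_mul_of_nonneg_left hstep1 (mul_nonneg (by linarith) (pow_nonneg ha.le _))
      _ ≤ (α - 1) * (1 / α) ^ (m + 3) * (Ic / dR) := by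
          apply mul_le_mul_of_nonneg_right _ hIc0
          exact mul_le_mul_of_nonneg_left (haq (m + 3)) (by linarith)
      _ = (α - 1) * Ic / (dR * α ^ (m + 3)) := by
          rw [one_div, inv_pow]; field_simp
  linarith

/-- The real-inequality core of (S1b): `W`-part `≥ 0`, residual through `S^μ ≤ S`, `I^μ ≥ 0`.
[cite: FitznerVanDerHofstad2016NoBLE, §3.3.5 (3.62) p. 1076] -/
theorem stepOne_lower_alg {a α dR W I S Sc : ℝ} (m : ℕ) (ha : 0 < a) (hα : 1 ≤ α)
    (hale : a ≤ 1 / α) (hd : 0 < dR) (hW0 : 0 ≤ W) (hI0 : 0 ≤ I) (hS0 : 0 ≤ S) (hSle : S ≤ Sc) :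
    -((α - 1) * Sc / (2 * dR ^ 2 * α ^ (m + 3)))
      ≤ a ^ (m + 2) * W + (α - 1) * a ^ (m + 3) * (I / dR - S / (2 * dR ^ 2)) := by
  have hα0 : 0 < α := by linarith
  have haq : ∀ q : ℕ, a ^ q ≤ (1 / α) ^ q := fun q => pow_le_pow_left₀ ha.le hale q
  have h1 : 0 ≤ a ^ (m + 2) * W := mul_nonneg (pow_nonneg ha.le _) hW0
  have hcoef : 0 ≤ (α - 1) * a ^ (m + 3) := mul_nonneg (by linarith) (pow_nonneg ha.le _)
  have hSc0 : 0 ≤ Sc := le_trans hS0 hSle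
  have h2 : -((α - 1) * Sc / (2 * dR ^ 2 * α ^ (m + 3)))
      ≤ (α - 1) * a ^ (m + 3) * (I / dR - S / (2 * dR ^ 2)) := by
    have hstep : -(S / (2 * dR ^ 2)) ≤ I / dR - S / (2 * dR ^ 2) := by
      have : 0 ≤ I / dR := div_nonneg hI0 hd.le
      linarith
    calc -((α - 1) * Sc / (2 * dR ^ 2 * α ^ (m + 3)))
        = (α - 1) * (1 / α) ^ (m + 3) * (-(Sc / (2 * dR ^ 2))) := by
          rw [one_div, inv_pow]; field_simp
      _ ≤ (α - 1) * a ^ (m + 3) * (-(Sc / (2 * dR ^ 2))) := by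
          have hneg : -(Sc / (2 * dR ^ 2)) ≤ 0 := by
            have : 0 ≤ Sc / (2 * dR ^ 2) := by positivity
            linarith
          exact mul_le_mul_of_nonpos_right (mul_le_mul_of_nonneg_left (haq (m + 3)) (by linarith)) hneg
      _ ≤ (α - 1) * a ^ (m + 3) * (-(S / (2 * dR ^ 2))) := by
          apply mul_le_mul_of_nonneg_left _ hcoef
          have := div_le_div_of_nonneg_right hSle (show (0 : ℝ) ≤ 2 * dR ^ 2 by positivity)
          linarith
      _ ≤ (α - 1) * a ^ (m + 3) * (I / dR - S / (2 * dR ^ 2)) :=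
          mul_le_mul_of_nonneg_left hstep hcoef
  linarith

section StepOne

variable {cΦ αΦ cF αF : ℝ} {RΦ RF : Site d → ℝ}

/-- The expansion of `X_{m,l}` regrouped around the massive weighted line:
`X = a^{m+2}·W + (α_F − 1) a^{m+3} [I^μ_{m+3,l}/d − Σ_{±ι} I^μ_{m+3,l}(x±2e_ι)/(2d²)]` with
`W = I^μ_{m+2,l+1} − (μ/d) I^μ_{m+3,l} + (μ/2d²) Σ…` (`μ W = srwJm`, since `μ = α_F a`).
[cite: FitznerVanDerHofstad2016NoBLE, §3.3.5 (3.61) p. 1076] -/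
theorem integral_Cstar_pow_Mstar_eq_weightedLine (hd : 1 ≤ d) (hc0 : cF + αF + cosFT RF 0 < 1)
    (hα : 0 ≤ αF) (m l : ℕ) (x : Site d) :
    (∫ k, (lapAtomsAt d cΦ αΦ cF αF RΦ RF k).Cstar ^ (m + 2) * (lapAtomsAt d cΦ αΦ cF αF RΦ RF k).Mstar *
        (Dhat d k ^ l * DhatSym d x k) ∂P d) / (2 * π) ^ d
      = stepOneA cF αF RF ^ (m + 2) *
          (srwIm d (stepOneMu cF αF RF) (m + 2) (l + 1) x
            - stepOneMu cF αF RF / d * srwIm d (stepOneMu cF αF RF) (m + 3) l x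
            + stepOneMu cF αF RF / (2 * (d : ℝ) ^ 2) *
              ∑ ι, (srwIm d (stepOneMu cF αF RF) (m + 3) l (x + axisVec ι 2)
                    + srwIm d (stepOneMu cF αF RF) (m + 3) l (x - axisVec ι 2)))
        + (αF - 1) * stepOneA cF αF RF ^ (m + 3) *
          (srwIm d (stepOneMu cF αF RF) (m + 3) l x / d
            - (∑ ι, (srwIm d (stepOneMu cF αF RF) (m + 3) l (x + axisVec ι 2)
                      + srwIm d (stepOneMu cF αF RF) (m + 3) l (x - axisVec ι 2))) / (2 * (d : ℝ) ^ 2)) := by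
  rw [integral_Cstar_pow_Mstar_eq (cΦ := cΦ) (αΦ := αΦ) (RΦ := RΦ) hd hc0 hα (m + 2) l x,
    show m + 2 + 1 = m + 3 by omega, stepOneMu]
  ring

/-- `μ · W = srwJm` for the `W` of `integral_Cstar_pow_Mstar_eq_weightedLine`. [folklore] -/
theorem stepOne_mul_W_eq_srwJm (μ : ℝ) (m l : ℕ) (x : Site d) :
    μ * (srwIm d μ (m + 2) (l + 1) x - μ / d * srwIm d μ (m + 3) l x
        + μ / (2 * (d : ℝ) ^ 2) *
          ∑ ι, (srwIm d μ (m + 3) l (x + axisVec ι 2) + srwIm d μ (m + 3) l (x - axisVec ι 2)))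
      = srwJm d μ (m + 2) l x := by
  rw [srwJm, show m + 2 + 1 = m + 3 by omega]; ring

/-- **(S1a) — corrected (3.62), upper side.** On the window (`c_F + α_F + R̂_F(0) < 1`), `α_F ≥ 1`, `2(m+3)+1 ≤ d`:
`∫ Ĉ*^{m+2} M̂* D̂^l D̂^{(x)} dP/(2π)^d ≤ 𝓙_{m,l}(x)/α_F^{m+2} + (α_F − 1) I_{m+3,l}(x)/(d α_F^{m+3})`, `𝓙_{m,l} = srwJ d (m+2) l`.
[cite: FitznerVanDerHofstad2016NoBLE, §3.3.5 (3.61)–(3.62) p. 1076] -/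
theorem integral_Cstar_pow_Mstar_le {m : ℕ} (hd : 2 * (m + 3) + 1 ≤ d)
    (hc0 : cF + αF + cosFT RF 0 < 1) (hα : 1 ≤ αF) (l : ℕ) (x : Fin d → ℤ) :
    (∫ k, (lapAtomsAt d cΦ αΦ cF αF RΦ RF k).Cstar ^ (m + 2) * (lapAtomsAt d cΦ αΦ cF αF RΦ RF k).Mstar *
        (Dhat d k ^ l * DhatSym d x k) ∂P d) / (2 * π) ^ d
      ≤ srwJ d (m + 2) l x / αF ^ (m + 2) + (αF - 1) * srwI d (m + 3) l x / (d * αF ^ (m + 3)) := by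
  have hd1 : 1 ≤ d := by omega
  have hα0 : 0 < αF := by linarith
  obtain ⟨ha, hμ0, hμ1⟩ := stepOne_params (d := d) (RF := RF) hc0 hα0.le
  rw [integral_Cstar_pow_Mstar_eq_weightedLine (cΦ := cΦ) (αΦ := αΦ) (RΦ := RΦ) hd1 hc0 hα0.le m l x]
  have hμpos : 0 < stepOneMu cF αF RF := by unfold stepOneMu; positivity
  have hJ := stepOne_mul_W_eq_srwJm (d := d) (stepOneMu cF αF RF) m l x
  have hW0 : 0 ≤ srwIm d (stepOneMu cF αF RF) (m + 2) (l + 1) x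
      - stepOneMu cF αF RF / d * srwIm d (stepOneMu cF αF RF) (m + 3) l x
      + stepOneMu cF αF RF / (2 * (d : ℝ) ^ 2) *
        ∑ ι, (srwIm d (stepOneMu cF αF RF) (m + 3) l (x + axisVec ι 2)
              + srwIm d (stepOneMu cF αF RF) (m + 3) l (x - axisVec ι 2)) := by
    have h := srwJm_nonneg hd1 hμ0 hμ1 m l x
    rw [← hJ] at h
    exact (mul_nonneg_iff_of_pos_left hμpos).1 h
  have hWle := (hJ.le).trans (srwJm_le_srwJ hd hμ0 hμ1 l x)
  exact stepOne_upper_alg m rfl ha hα (stepOneA_le_inv hc0.le hα0)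
    (by exact_mod_cast (show 0 < d by omega)) hW0 hWle (srwIm_nonneg hμ0 hμ1 _ _ _)
    (srwIm_le_srwI (n := m + 3) hd hμ0 hμ1 l x)
    (Finset.sum_nonneg fun ι _ => add_nonneg (srwIm_nonneg hμ0 hμ1 _ _ _) (srwIm_nonneg hμ0 hμ1 _ _ _))

/-- **(S1b) — corrected (3.62), lower side.** On the window, `α_F ≥ 1`, `2(m+3)+1 ≤ d`:
`−(α_F − 1) Σ_{±ι} I_{m+3,l}(x ± 2e_ι)/(2d² α_F^{m+3}) ≤ ∫ Ĉ*^{m+2} M̂* D̂^l D̂^{(x)} dP/(2π)^d`.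
[cite: FitznerVanDerHofstad2016NoBLE, §3.3.5 (3.61)–(3.62) p. 1076] -/
theorem neg_le_integral_Cstar_pow_Mstar {m : ℕ} (hd : 2 * (m + 3) + 1 ≤ d)
    (hc0 : cF + αF + cosFT RF 0 < 1) (hα : 1 ≤ αF) (l : ℕ) (x : Fin d → ℤ) :
    -((αF - 1) * srwIShift2 d (m + 3) l x / (2 * (d : ℝ) ^ 2 * αF ^ (m + 3)))
      ≤ (∫ k, (lapAtomsAt d cΦ αΦ cF αF RΦ RF k).Cstar ^ (m + 2) * (lapAtomsAt d cΦ αΦ cF αF RΦ RF k).Mstar *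
        (Dhat d k ^ l * DhatSym d x k) ∂P d) / (2 * π) ^ d := by
  have hd1 : 1 ≤ d := by omega
  have hα0 : 0 < αF := by linarith
  obtain ⟨ha, hμ0, hμ1⟩ := stepOne_params (d := d) (RF := RF) hc0 hα0.le
  rw [integral_Cstar_pow_Mstar_eq_weightedLine (cΦ := cΦ) (αΦ := αΦ) (RΦ := RΦ) hd1 hc0 hα0.le m l x]
  have hμpos : 0 < stepOneMu cF αF RF := by unfold stepOneMu; positivity
  have hJ := stepOne_mul_W_eq_srwJm (d := d) (stepOneMu cF αF RF) m l x
  have hW0 : 0 ≤ srwIm d (stepOneMu cF αF RF) (m + 2) (l + 1) x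
      - stepOneMu cF αF RF / d * srwIm d (stepOneMu cF αF RF) (m + 3) l x
      + stepOneMu cF αF RF / (2 * (d : ℝ) ^ 2) *
        ∑ ι, (srwIm d (stepOneMu cF αF RF) (m + 3) l (x + axisVec ι 2)
              + srwIm d (stepOneMu cF αF RF) (m + 3) l (x - axisVec ι 2)) := by
    have h := srwJm_nonneg hd1 hμ0 hμ1 m l x
    rw [← hJ] at h
    exact (mul_nonneg_iff_of_pos_left hμpos).1 h
  have hSle : ∑ ι, (srwIm d (stepOneMu cF αF RF) (m + 3) l (x + axisVec ι 2)
        + srwIm d (stepOneMu cF αF RF) (m + 3) l (x - axisVec ι 2)) ≤ srwIShift2 d (m + 3) l x := by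
    unfold srwIShift2
    exact Finset.sum_le_sum fun ι _ => add_le_add
      (srwIm_le_srwI (n := m + 3) hd hμ0 hμ1 l _) (srwIm_le_srwI (n := m + 3) hd hμ0 hμ1 l _)
  exact stepOne_lower_alg m ha hα (stepOneA_le_inv hc0.le hα0)
    (by exact_mod_cast (show 0 < d by omega)) hW0 (srwIm_nonneg hμ0 hμ1 _ _ _)
    (Finset.sum_nonneg fun ι _ => add_nonneg (srwIm_nonneg hμ0 hμ1 _ _ _) (srwIm_nonneg hμ0 hμ1 _ _ _)) hSle

end StepOne

end Literature.Probability.FitznerVanDerHofstad2017
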